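import Summits.PneNP.PneNP.Theorems.ChebyshevTracialDesignLowDegreeHolds
import HarnessLib

/-!
# Cell pnp-psdrank, route `ChebyshevTracialDesign`: the SIGN cell is MATCHING-ADAPTED — an exact design prices `≤ 0` every kernel whose
# cut-side Gram factor is low-degree SEPARATELY FOR EACH MATCHING, and hence every contraction field that is a low-degree Gram field on the
# range of the test projection `P_M` (crux `TracialDecayExp20`, stmt-PneNP-19878)

Brick 88b (prover g17; MEMO-20 §1). Brick 23 (`…JuntaLowDegree.sum_levelWeight_trace_nonpos_of_lowDegree`, unconditional since
`Grigoriev2001_knapsackFormNonneg_holds`) prices `Σ_{U,M} W(U,M)·tr(A_U A_Uᵀ Y_M) ≤ 0` for ONE cut-side factor `A` of Johnson degree `≤ k`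
(`2k ≤ D`, `4k ≤ t`) against an arbitrary psd matching side. Its proof is pointwise in `M`: for each perfect matching `M` the level sums of
`U ↦ tr(A_U A_Uᵀ Y_M)` are `T(n/2; c, i)·P_M(c)` with `deg P_M ≤ 2k ≤ D` and `P_M(0) ≥ 0` a sum of Grigoriev knapsack forms (`lowdeg_sum_law`),
and exactness gives `Σ_c w_c P_M(c) = −P_M(0) ≤ 0`. So the factor may DEPEND ON THE MATCHING:
* §1 **`sum_levelWeight_trace_nonpos_of_adaptedLowDegree`** — for an exact design of degree `D` on the `t`-cuts and a family of cut-side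
  factors `A^{(M)}_U` (`r × m`), one for each perfect matching `M`, EACH of Johnson degree `≤ k` in `U` (`2k ≤ D`, `4k ≤ t`), and any psd
  `Y_M`: `Σ_{U,M} W(U,M)·tr(A^{(M)}_U (A^{(M)}_U)ᵀ Y_M) ≤ 0`. In kernel language: the design is nonpositive on the cone
  `𝒞_X = {K : K(·, M) is a degree-≤k Gram/SOS function of U for every M}` — the cut-side multipliers of a SIGN certificate may vary with `M`
  arbitrarily (no regularity in `M` whatsoever).
* §2 **`sum_levelWeight_trace_proj_nonpos_of_rangeLowDegree`** — the DIRECTIONAL SIGN CELL for the one-sided form of the crux (brick 86: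
  `value = Σ_{U,M} W·tr(X_U P_M)`, `P_M` a projection): if for each `M` the compression `P_M X_U P_M` of the cut field to the range of the
  test projection is a Gram field `A^{(M)}_U (A^{(M)}_U)ᵀ` of Johnson degree `≤ k` in `U`, then `Σ_{U,M} W(U,M)·tr(X_U P_M) ≤ 0` — for ANY
  symmetric idempotents `P_M` and any `X` (no contraction or psd hypothesis on `X` is needed beyond the Gram representation of the
  compressions). 'Low degree in the directions that `M` tests' is the by-name SIGN criterion matching MEMO-19 §2(h)'s request that the blocks
  of a psd-preserving decomposition be allowed to depend on the matching side (brick 88 `…BlockDecomposition` prices the blocks).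
[cite: Grigoriev2001, Lemma 1.4 (PDF p. 8)] [cite: Rothvoss2017, §2 (PDF p. 6)] [cite: GriblingDelaatLaurent2019, §5]
Stature: support/instrument (kernel lane, no defs, axioms standard). WHAT THIS IS NOT: no decomposition theorem, no proof or refutation of the
crux, nothing on psd rank of P_PM(K_n), no P-vs-NP content. Supports stmt-PneNP-19878.
-/

set_option linter.dupNamespace false -- `Summit.PneNP.PneNP.…`: summit = sub-problem (D-0017)

noncomputable section

namespace Summit.PneNP.PneNP.Theorems.ChebyshevTracialDesignAdaptedLowDegree

open Finset Matrix Polynomial Literature.Barriers.PneNP Literature.Combinatorics.SimpleGraph.CycleSpace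
open Literature.Computability.Complexity Literature.Combinatorics.Optimization
open Summit.PneNP.PneNP.Theorems.ChebyshevTracialDesignJunta
open scoped MatrixOrder

variable {n : ℕ}

/-! ### §1 Matching-adapted low-degree cut factors have nonpositive design value -/

/-- **MATCHING-ADAPTED SIGN CELL.** For an exact design `(n, t, T, D, B_v, C, w)`, a family of cut-side factors `A^{(M)} : OddSet n → ℝ^{r×m}`
indexed by the perfect matchings, each of Johnson degree `≤ k` (`IsLowDegreeU n k (A M)`), with `2k ≤ D`, `4k ≤ t`, and any psd family `Y_M`:
`Σ_U Σ_M levelWeight(U,M)·tr(A^{(M)}_U (A^{(M)}_U)ᵀ Y_M) ≤ 0`. (Brick 23 is the case of a constant family `A^{(M)} = A`.) Per matching the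
level sums are `T(n/2;c,i)·P_M(c)`, `deg P_M ≤ D`, `P_M(0) ≥ 0` by Grigoriev's knapsack Lemma 1.4 (`lowdeg_sum_law` with the coefficients of
`A^{(M)}`), and the design extrapolates each `P_M` exactly. [cite: Grigoriev2001, Lemma 1.4 (PDF p. 8)] [cite: Rothvoss2017, §2 (PDF p. 6)] -/
theorem sum_levelWeight_trace_nonpos_of_adaptedLowDegree
    {t T D : ℕ} {Bv : ℝ} {C : Finset ℕ} {w : ℕ → ℝ} (hdes : IsExactDesign n t T D Bv C w)
    {r m k : ℕ} (h2k : 2 * k ≤ D) (h4k : 4 * k ≤ t)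
    (A : PMatch n → OddSet n → Matrix (Fin r) (Fin m) ℝ) (hA : ∀ M, IsLowDegreeU n k (A M))
    (Y : PMatch n → Matrix (Fin r) (Fin r) ℝ) (hYpsd : ∀ M, (Y M).PosSemidef) :
    ∑ U, ∑ M, levelWeight n t C w U M * (A M U * (A M U)ᵀ * Y M).trace ≤ 0 := by
  have hG : Grigoriev2001_knapsackFormNonneg := Grigoriev2001_knapsackFormNonneg_holds
  obtain ⟨htodd, htn, hTt, hC, -, hexact, -⟩ := hdes
  -- coefficients of the low-degree entries, per matching
  have hα' : ∀ M a j, ∃ c : {A' : Finset (Fin n) // A'.card ≤ k} → ℝ,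
      ∑ A', c A' • (fun U : OddSet n => if A'.1 ⊆ U.1 then (1 : ℝ) else 0) = fun U => A M U a j :=
    fun M a j => (Submodule.mem_span_range_iff_exists_fun ℝ).1 (hA M a j)
  choose α hα using hα'
  have hAeval : ∀ (M : PMatch n) (U : OddSet n) a j,
      A M U a j = ∑ A' : {A' : Finset (Fin n) // A'.card ≤ k}, α M a j A' * (if A'.1 ⊆ U.1 then (1 : ℝ) else 0) := by
    intro M U a j
    have := congrFun (hα M a j) U
    rw [Finset.sum_apply] at this
    rw [← this]
    exact sum_congr rfl fun A' _ => by rw [Pi.smul_apply, smul_eq_mul]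
  -- Step 1: the value as level sums
  have hval : ∑ U, ∑ M, levelWeight n t C w U M * (A M U * (A M U)ᵀ * Y M).trace =
      ∑ c ∈ C, w c / ((Qset n t c).card : ℝ) *
        ∑ M : PMatch n, ∑ U : OddSet n,
          (if U.1.card = t ∧ cc U M = c then (A M U * (A M U)ᵀ * Y M).trace else 0) := by
    calc ∑ U, ∑ M, levelWeight n t C w U M * (A M U * (A M U)ᵀ * Y M).trace
        = ∑ U, ∑ M, ∑ c ∈ C, (if (U, M) ∈ Qset n t c then
            w c / ((Qset n t c).card : ℝ) * (A M U * (A M U)ᵀ * Y M).trace else 0) := by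
          refine sum_congr rfl fun U _ => sum_congr rfl fun M _ => ?_
          rw [levelWeight, sum_mul]
          exact sum_congr rfl fun c _ => by split_ifs <;> simp
      _ = ∑ U, ∑ c ∈ C, ∑ M, (if (U, M) ∈ Qset n t c then
            w c / ((Qset n t c).card : ℝ) * (A M U * (A M U)ᵀ * Y M).trace else 0) := sum_congr rfl fun U _ => sum_comm
      _ = ∑ c ∈ C, ∑ U, ∑ M, (if (U, M) ∈ Qset n t c then
            w c / ((Qset n t c).card : ℝ) * (A M U * (A M U)ᵀ * Y M).trace else 0) := sum_comm
      _ = ∑ c ∈ C, w c / ((Qset n t c).card : ℝ) *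
            ∑ M : PMatch n, ∑ U : OddSet n,
              (if U.1.card = t ∧ cc U M = c then (A M U * (A M U)ᵀ * Y M).trace else 0) := by
          refine sum_congr rfl fun c _ => ?_
          rw [mul_sum, sum_comm]
          refine sum_congr rfl fun M _ => ?_
          rw [mul_sum]
          refine sum_congr rfl fun U _ => ?_
          simp only [mem_Qset_iff]
          split_ifs <;> simp
  -- Step 2: per matching, the polynomial from the low-degree sum law (with the coefficients of `A^{(M)}`)
  have hN : ∀ M : PMatch n, M.1.card = n / 2 := fun M => by have := two_mul_card_pmatch M; omega
  have hP : ∀ M : PMatch n, ∃ P : Polynomial ℝ, P.natDegree ≤ D ∧ 0 ≤ P.eval 0 ∧ ∀ c i : ℕ, c + 2 * i = t →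
      ∑ U : OddSet n, (if U.1.card = t ∧ cc U M = c then (A M U * (A M U)ᵀ * Y M).trace else 0) =
        (((n / 2).choose (c + i) * (c + i).choose i * 2 ^ c : ℕ) : ℝ) * P.eval (c : ℝ) := by
    intro M
    have hMt : t + 1 ≤ M.1.card := by have := two_mul_card_pmatch M; omega
    have hk : 2 * k ≤ M.1.card := by omega
    have hr₁ : (k : ℝ) - 1 < (t : ℝ) / 2 := by
      have : (4 : ℝ) * k ≤ t := by exact_mod_cast h4k
      linarith
    have hr₂ : (t : ℝ) / 2 < (M.1.card : ℝ) - k + 1 := by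
      have h1 : (4 : ℝ) * k ≤ t := by exact_mod_cast h4k
      have h2 : (t : ℝ) + 1 ≤ M.1.card := by exact_mod_cast hMt
      linarith
    obtain ⟨P, hPdeg, hP0, hPval⟩ := lowdeg_sum_law hG M hk hr₁ hr₂ (α M) (Y M) (hYpsd M)
    refine ⟨P, hPdeg.trans h2k, hP0, fun c i hci => ?_⟩
    rw [sum_oddSet_level_eq M hci (fun U => A M U * (A M U)ᵀ) Y, ← hN M, ← hPval c i hci]
    refine sum_congr rfl fun U' hU' => ?_
    have hodd : Odd U'.card := by
      obtain ⟨-, hc, hi⟩ := mem_filter.1 hU'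
      have h := card_eq_cr_add_two_mul_in M.2 (subset_univ U')
      rw [hc, hi, hci] at h
      exact h ▸ htodd
    rw [dif_pos hodd, trace_mul_transpose_mul_eq]
    refine sum_congr rfl fun j _ => sum_congr rfl fun a _ => sum_congr rfl fun b _ => ?_
    rw [hAeval M ⟨U', hodd⟩ a j, hAeval M ⟨U', hodd⟩ b j]
  choose P hPdeg hP0 hPval using hP
  -- Step 3: |Q_c| = #PM · T(n/2; c, i)
  have hQ : ∀ c i : ℕ, c + 2 * i = t → ((Qset n t c).card : ℝ) =
      (Fintype.card (PMatch n) : ℝ) * (((n / 2).choose (c + i) * (c + i).choose i * 2 ^ c : ℕ) : ℝ) := by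
    intro c i hci
    have e1 : ((Qset n t c).card : ℝ) =
        ∑ M : PMatch n, ∑ U : OddSet n, (if U.1.card = t ∧ cc U M = c then (1 : ℝ) else 0) := by
      rw [Qset, Finset.card_filter, Nat.cast_sum, Fintype.sum_prod_type, sum_comm]
      refine sum_congr rfl fun M _ => sum_congr rfl fun U _ => ?_
      split_ifs <;> simp
    have e2 : ∀ M : PMatch n, ∑ U : OddSet n, (if U.1.card = t ∧ cc U M = c then (1 : ℝ) else 0) =
        (((n / 2).choose (c + i) * (c + i).choose i * 2 ^ c : ℕ) : ℝ) := by
      intro M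
      have key := sum_oddSet_level_eq M hci (r := 1) (fun _ => 1) (fun _ => 1)
      simp only [Matrix.mul_one, trace_one, Fintype.card_fin, Nat.cast_one, dite_eq_ite] at key
      rw [key]
      have hodd : ∀ U' ∈ (univ : Finset (Fin n)).powerset.filter (fun U' =>
          (M.1.filter fun e => cutCount U' e = 1).card = c ∧ (M.1.filter fun e => cutCount U' e = 2).card = i),
          (if Odd U'.card then (1 : ℝ) else 0) = 1 := by
        intro U' hU'
        rw [mem_filter] at hU'
        have hc := card_eq_cr_add_two_mul_in M.2 (subset_univ U')
        rw [hU'.2.1, hU'.2.2, hci] at hc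
        rw [if_pos (hc ▸ htodd)]
      rw [sum_congr rfl hodd, sum_const, nsmul_eq_mul, mul_one, card_filter_cr_in_eq M.2, hN M]
    rw [e1, Fintype.sum_congr _ _ e2, sum_const, card_univ, nsmul_eq_mul]
  -- Step 4: assemble
  rw [hval]
  have hterm : ∀ c ∈ C, w c / ((Qset n t c).card : ℝ) *
      ∑ M : PMatch n, ∑ U : OddSet n,
        (if U.1.card = t ∧ cc U M = c then (A M U * (A M U)ᵀ * Y M).trace else 0) =
      (Fintype.card (PMatch n) : ℝ)⁻¹ * ∑ M : PMatch n, w c * (P M).eval (c : ℝ) := by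
    intro c hc
    obtain ⟨hcodd, -, hcT, hne⟩ := hC c hc
    obtain ⟨i, hi⟩ : ∃ i, c + 2 * i = t := by
      obtain ⟨a, ha⟩ := hcodd; obtain ⟨b, hb⟩ := htodd; exact ⟨b - a, by omega⟩
    have hQc := hQ c i hi
    have hQ0 : ((Qset n t c).card : ℝ) ≠ 0 := by exact_mod_cast (card_pos.2 hne).ne'
    have hT0 : (((n / 2).choose (c + i) * (c + i).choose i * 2 ^ c : ℕ) : ℝ) ≠ 0 := by
      intro h0; rw [h0, mul_zero] at hQc; exact hQ0 hQc
    rw [sum_congr rfl fun M _ => hPval M c i hi, ← mul_sum, hQc, mul_sum, mul_sum, mul_sum]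
    refine sum_congr rfl fun M _ => ?_
    field_simp
  rw [sum_congr rfl hterm, ← mul_sum, sum_comm]
  have hinner : ∀ M : PMatch n, ∑ c ∈ C, w c * (P M).eval (c : ℝ) = -(P M).eval 0 :=
    fun M => hexact (P M) (hPdeg M)
  rw [Fintype.sum_congr _ _ hinner]
  exact mul_nonpos_of_nonneg_of_nonpos (inv_nonneg.2 (Nat.cast_nonneg _))
    (by rw [sum_neg_distrib, neg_nonpos]; exact sum_nonneg fun M _ => hP0 M)

/-! ### §2 The directional SIGN cell: cut fields that are low-degree Gram fields on the range of the test projection -/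

/-- `tr(X P) = tr(P X P)` for an idempotent `P`. [folklore] -/
theorem trace_mul_proj_eq {r : ℕ} (X P : Matrix (Fin r) (Fin r) ℝ) (hP : P * P = P) :
    (X * P).trace = (P * X * P).trace := by
  rw [Matrix.mul_assoc, Matrix.trace_mul_comm P (X * P), Matrix.mul_assoc, hP]

/-- **DIRECTIONAL SIGN CELL (one-sided form).** Let `(n, t, T, D, B_v, C, w)` be an exact design, `X : OddSet n → ℝ^{r×r}` ANY cut field and
`P_M` idempotent test matrices (`P_M² = P_M`; in the crux's one-sided form, brick 86, `P_M` is the positive spectral projection of the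
virtual average). If for every perfect matching `M` the compression `P_M X_U P_M` is a Gram field `A^{(M)}_U (A^{(M)}_U)ᵀ` of Johnson degree
`≤ k` in `U` (`2k ≤ D`, `4k ≤ t`), then `Σ_{U,M} levelWeight(U,M)·tr(X_U P_M) ≤ 0`: a cut field that is low-degree IN THE DIRECTIONS EACH
MATCHING TESTS is priced `≤ 0`, whatever its degree elsewhere. [cite: Grigoriev2001, Lemma 1.4 (PDF p. 8)] [cite: Rothvoss2017, §2 (PDF p. 6)]
[cite: GriblingDelaatLaurent2019, §5] -/
theorem sum_levelWeight_trace_proj_nonpos_of_rangeLowDegree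
    {t T D : ℕ} {Bv : ℝ} {C : Finset ℕ} {w : ℕ → ℝ} (hdes : IsExactDesign n t T D Bv C w)
    {r m k : ℕ} (h2k : 2 * k ≤ D) (h4k : 4 * k ≤ t)
    (X : OddSet n → Matrix (Fin r) (Fin r) ℝ) (P : PMatch n → Matrix (Fin r) (Fin r) ℝ) (hP : ∀ M, P M * P M = P M)
    (A : PMatch n → OddSet n → Matrix (Fin r) (Fin m) ℝ) (hA : ∀ M, IsLowDegreeU n k (A M))
    (hXP : ∀ M U, P M * X U * P M = A M U * (A M U)ᵀ) :
    ∑ U, ∑ M, levelWeight n t C w U M * (X U * P M).trace ≤ 0 := by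
  have h1 : ∀ U M, (X U * P M).trace = (A M U * (A M U)ᵀ * (1 : Matrix (Fin r) (Fin r) ℝ)).trace := fun U M => by
    rw [trace_mul_proj_eq (X U) (P M) (hP M), hXP M U, Matrix.mul_one]
  simp_rw [h1]
  exact sum_levelWeight_trace_nonpos_of_adaptedLowDegree hdes h2k h4k A hA (fun _ => 1) fun _ => Matrix.PosSemidef.one

end Summit.PneNP.PneNP.Theorems.ChebyshevTracialDesignAdaptedLowDegree

end
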